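import Summits.BirchSwinnertonDyer.BirchSwinnertonDyer.Theorems.KolyvaginDepthDoorKolyvaginDepthSupplyAdmissibleDataKN
import Literature.NumberTheory.EllipticCurves.SupersingularDensitySerreFrobeniusProofs
import HarnessLib

/-!
# Route `KolyvaginDepthDoor`, crux `KolyvaginDepthSupplyKN` (stmt-BirchSwinnertonDyer-22820) —
# stub `stub_largeAdmissiblePrime` of the supply skeleton: admissible Kodaira–Néron primes of a non-CM
# curve lie above every bound (unconditional)

Helper file for the crux's supply skeleton (`Cruxes/KolyvaginDepthSupplyKN/Lines/levelone.lean`,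
stub `stub_largeAdmissiblePrime`, signature verbatim below); it closes nothing and BSD is not proved by
it.

The skeleton chooses the Heegner field `K` FIRST (Bump–Friedberg–Hoffstein / Hoffstein–Luo, so that
`rank E^{(d_K)}(ℚ) ≤ 1` and `Ш(E^{(d_K)})` is finite by Gross–Zagier–Kolyvagin) and the witness prime
`p` AFTERWARDS, above a bound depending on `(E, K)` (`|d_K|`, `#Ш(E^{(d_K)})`, the `Ш(E)[p] = 0`
threshold of the open stub). This file supplies that prime with every side condition the crux and
W. Zhang's Theorem 1.1 / Lemma 8.4 ask of it, for EVERY bound `B`: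

* `not_dvd_padicValInt_minimalDiscriminantInt_of_natAbs_lt` — Hypothesis ♠ (1) in W. Zhang's
  `ℓ`-currency above the minimal discriminant: for `p > |Δ_min|` and every prime `ℓ` of multiplicative
  reduction, `p ∤ v_ℓ(Δ_min)` (`1 ≤ v_ℓ(Δ_min) < ℓ^{v_ℓ(Δ_min)} ≤ |Δ_min| < p`).
* `exists_large_admissiblePrime_kodairaNeron_of_not_hasCM` — for `E/ℚ` non-CM globally minimal and
  any `B`: a prime `p > B`, `p ≥ 5`, of good ordinary reduction, with `ρ̄_{E,p}` onto, the whole tower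
  `ρ̄_{E,p^n}` onto (Serre IV-23 / Wuthrich Lemma 20 at an ordinary prime, tree theorem
  `forall_hasSurjectiveModNGaloisRep_pow_of_goodOrdinary_of_surj`), and the Kodaira–Néron condition in
  both currencies (`ℓ`: `padicValInt ℓ Δ_min`; `v`: `ordMinimalDiscriminant v`, g9's
  `not_dvd_ordMinimalDiscriminant_of_natAbs_lt`). Source of `p`: g2's
  `exists_admissiblePrime_heegnerField_gt_of_not_hasCM` (Serre's open image theorem + infinitely many
  good ordinary primes, discharged tree theorems).

Unconditional; BSD is not proved by it.

References: [Serre1972] §4.2 Thm. 2; [SerreAbelianLadic1968] IV-23 Lemma 3; [Wuthrich2014] Lemma 20;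
[SilvermanAEC2009] VII.5.1, VIII.8; [WZhang2014] Hypothesis ♠ (p. 195).
-/

set_option linter.dupNamespace false

noncomputable section

open scoped Classical NumberField

namespace Summit.BirchSwinnertonDyer.BirchSwinnertonDyer.Theorems.KolyvaginDepthDoor

open Literature.NumberTheory.EllipticCurves Literature.NumberTheory.EllipticCurves.ModularForms
  WeierstrassCurve NumberField IsDedekindDomain

/-- **Hypothesis ♠ (1) above the minimal discriminant, `ℓ`-currency (unconditional).** For `W/ℚ`
globally minimal elliptic and `p > |Δ_min|`: every prime `ℓ` of multiplicative reduction has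
`p ∤ v_ℓ(Δ_min)` — multiplicative reduction is bad, so `ℓ ∣ Δ_min` (`natCast_dvd_minimalDiscriminantInt_of_not_hasGoodReductionAtPrime`),
`1 ≤ v_ℓ(Δ_min) < ℓ^{v_ℓ(Δ_min)} ≤ |Δ_min| < p`. [cite: SilvermanAEC2009, VII.5.1]
[cite: WZhang2014, Hypothesis ♠ (1) (p. 195)] -/
theorem not_dvd_padicValInt_minimalDiscriminantInt_of_natAbs_lt (W : WeierstrassCurve ℚ)
    [W.IsElliptic] [W.IsGloballyMinimal] {p : ℕ} (hp : W.minimalDiscriminantInt.natAbs < p)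
    (ℓ : ℕ) [hℓ : Fact ℓ.Prime] (hmult : W.HasMultiplicativeReductionAtPrime ℓ) :
    ¬ p ∣ padicValInt ℓ W.minimalDiscriminantInt := by
  have hbad : ¬ W.HasGoodReductionAtPrime ℓ := hmult.not_hasGoodReduction
  have hdvd : (ℓ : ℤ) ∣ W.minimalDiscriminantInt :=
    W.natCast_dvd_minimalDiscriminantInt_of_not_hasGoodReductionAtPrime ℓ hbad
  set n := W.minimalDiscriminantInt.natAbs with hn
  have hn0 : n ≠ 0 := by
    rw [hn, ne_eq, Int.natAbs_eq_zero]
    exact W.minimalDiscriminantInt_ne_zero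
  have hdvd' : ℓ ∣ n := by
    rw [hn]
    exact Int.natCast_dvd.mp hdvd
  have hv : padicValInt ℓ W.minimalDiscriminantInt = padicValNat ℓ n := rfl
  have hk1 : 1 ≤ padicValNat ℓ n :=
    (padicValNat_dvd_iff_le hn0).mp (by rw [pow_one]; exact hdvd')
  have hle : ℓ ^ padicValNat ℓ n ≤ n := Nat.le_of_dvd (Nat.pos_of_ne_zero hn0) pow_padicValNat_dvd
  have hlt : padicValNat ℓ n < ℓ ^ padicValNat ℓ n := Nat.lt_pow_self hℓ.out.one_lt
  rw [hv]
  intro h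
  have := Nat.le_of_dvd hk1 h
  omega

/-- **Admissible Kodaira–Néron primes above every bound (unconditional).** For every non-CM globally
minimal elliptic `E/ℚ` and every `B : ℕ` there is a prime `p > B`, `p ≥ 5`, of good ORDINARY reduction
with `ρ̄_{E,p}` onto, `ρ̄_{E,p^n}` onto for all `n`, and the Kodaira–Néron side condition in both
currencies: `p ∤ v_ℓ(Δ_min)` at every prime `ℓ` of multiplicative reduction (W. Zhang's Hypothesis
♠ (1)) and `p ∤ ord_v(Δ_min)` at every multiplicative place `v` (the crux's conjunct). Proof: g2's
`exists_admissiblePrime_heegnerField_gt_of_not_hasCM` above `max B |Δ_min|` (Serre's open image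
theorem, infinitely many good ordinary primes), the tower from
`forall_hasSurjectiveModNGaloisRep_pow_of_goodOrdinary_of_surj`, (KN) from the two lemmas above the
minimal discriminant. This is the stub `stub_largeAdmissiblePrime` of the crux's supply skeleton.
Unconditional; BSD is not proved by it. [cite: Serre1972, §4.2 Thm. 2]
[cite: SerreAbelianLadic1968, Ch. IV §3.4 Lemma 3] [cite: Wuthrich2014, Lemma 20]
[cite: SilvermanAEC2009, VII.5.1 and VIII.8] -/
theorem exists_large_admissiblePrime_kodairaNeron_of_not_hasCM (W : WeierstrassCurve ℚ)
    [W.IsElliptic] [W.IsGloballyMinimal] (hW : ¬ W.HasCM) (B : ℕ) :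
    ∃ (p : ℕ) (_ : Fact p.Prime), B < p ∧ 5 ≤ p ∧ W.HasGoodReductionAtPrime p ∧
      ¬ (p : ℤ) ∣ W.frobeniusTrace p ∧ W.HasSurjectiveModNGaloisRep p ∧
      (∀ n : ℕ, W.HasSurjectiveModNGaloisRep (p ^ n : ℕ)) ∧
      (∀ (ℓ : ℕ) [Fact ℓ.Prime], W.HasMultiplicativeReductionAtPrime ℓ →
        ¬ p ∣ padicValInt ℓ W.minimalDiscriminantInt) ∧
      (∀ v : HeightOneSpectrum (𝓞 ℚ), W.HasMultiplicativeReductionAt v →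
        ¬ p ∣ W.ordMinimalDiscriminant v) := by
  obtain ⟨p, hp, hB, h5, hgood, hord, hsurj, -⟩ :=
    exists_admissiblePrime_heegnerField_gt_of_not_hasCM W hW (max B W.minimalDiscriminantInt.natAbs)
  haveI := hp
  have hp2 : p ≠ 2 := by omega
  have hB' : B < p := lt_of_le_of_lt (le_max_left _ _) hB
  have hΔ : W.minimalDiscriminantInt.natAbs < p := lt_of_le_of_lt (le_max_right _ _) hB
  exact ⟨p, hp, hB', h5, hgood, hord, hsurj,
    WeierstrassCurve.forall_hasSurjectiveModNGaloisRep_pow_of_goodOrdinary_of_surj W p hp2 hgood hord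
      hsurj,
    fun ℓ _ hm ↦ not_dvd_padicValInt_minimalDiscriminantInt_of_natAbs_lt W hΔ ℓ hm,
    not_dvd_ordMinimalDiscriminant_of_natAbs_lt W hΔ⟩

end Summit.BirchSwinnertonDyer.BirchSwinnertonDyer.Theorems.KolyvaginDepthDoor

end
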